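import Mathlib
import HarnessLib
import Summits.HubbardSuperconductivity.HubbardSuperconductivity.Theorems.KLProgrammeKLRegimeSplitPredicatesV5
import Summits.HubbardSuperconductivity.HubbardSuperconductivity.Theorems.KLProgrammeKLRegimeSplitFrameLemmas
import Summits.HubbardSuperconductivity.HubbardSuperconductivity.Theorems.KLProgrammeKLRegimeSplitSpin01
import Summits.HubbardSuperconductivity.HubbardSuperconductivity.Theorems.KLProgrammeKLRegimeSplitGenericV2

/-!
# Route `KLProgramme` — crux K3 `KLRegimeTwoPointLimit` (stmt-HubbardSuperconductivity-19937): the predicate bundle VERSION 6 `klPredsV6`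
# = { FrameOK, RenormalisedAtF, BetaSplitAtS, EngineBoundsAtV4S, TwoLegStepG (histV6) }, with the Fermi-curve-read two-leg pieces «G»
# (FLAT cutoff + angular-MEAN split — the Δ13 repair (f1)+flat endorsed by p2 13:12:48Z) and the glue at V6

Cell gate-hubbard-kl; typist p1b g3 (director g6 INBOX 13:06:22Z (2); p2 g4 STATUS 13:12:48Z = fix letter + names; plan g10 13:13:29Z (4) = Δ13
ruling); two-leg objects v1 by p2 (`…SplitTwoLegF`: `klFermiPoint`, `klLocalPart`, `RenormalisedAtF`, `TwoLegSlopes` — REUSED), two-tier sizes and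
`FrameOK.mono` by p2 (`…SplitPredicatesV5`).

(i) WHY p2's pieces F/F2 DIE AT n = 0 (Δ13, p1b 13:01Z; confirmed p2 13:12Z, ruled REAL/BLOCKER g10 13:13Z).  `klFrameExt` multiplies the WHOLE
scale-`n` local-part increment — including its momentum-INDEPENDENT part (the ultraviolet step's first-order tadpole `τ₀U`, `τ₀ ≈ n_σ − ½ ≠ 0`
on the doped window; the slice tadpoles `c_nUΛ_n²`; K-insertion tadpoles) — by `klTubeCutoff`, whose radial derivatives are `≍ (160/3)ʲ` on the
annulus `3/160 < |ε−μ| < 3/80`; an `O(U)` constant becomes a radial bump with `‖D²ℓ₀‖ ≍ |τ₀|U(160/3)²` versus `twoLegBar 2 0 = S₂U²`, and the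
floor flips sign across the curve versus `−(Bf U² + Bf′|U|³)`: (E3a) `j ≥ 1` and (E3b) are false for every admissible frame and small `U`
(`j = 0` sizes and `RenormalisedAtF` are NOT hit).
(ii) WHY THE G-PIECES ARE SATISFIABLE at every `n` for every admissible frame and small `U`: (a) the cutoff `klFlatCutoff` is ≡ 1 on
`|ε − μ| ≤ 1/20` ⊃ `FrameOK`'s tube `{|e_K| < 3/80}` (+ any admissible `|K| ≤ (16/15)Gfr₀|U|`) ⊃ every shell (`e₀ = 1/32 < 1/20`), and bends only
on `(1/20, 1/10)` — inside `(−4, 0)` on `klWindowC`; so wherever (E3b) looks (the `FrameOK` tube) the pieces are PURE ANGULAR functions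
`f(θ(k))`, no `χ′`; (b) the momentum-independent part of every extended angular function is carried as its ANGULAR MEAN — a CONSTANT frame
(BGM 2003's constant part of `δε`, the chemical-potential flow; all derivatives vanish, value `≤ twoLegBar 0 n`) — and only the MEAN-FREE part
meets `χ`; the mean-free increments start at SECOND order (every tadpole is momentum-independent), so on the bending annulus
`‖Dʲℓ_n‖ ≲ (20·C)ʲ·U²(Λ_n/e₀)²·… ≤ twoLegBar j n` with ABSOLUTE `G.S j` — (E3a) `∀ q` and `FrameOK` (ii) `∀ q` stay satisfiable with `FrameOK`,
`twoLegBar`, `bflBar` UNCHANGED (why not g10's (f2)-shape with `FrameOK2`/test tube: not needed once the cutoff is flat on the whole inspected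
region, and it keeps the frame class — hence p2's `CounterMap`/`frameOK_counterterm` route and the UV step's global smoothness input —
verbatim; (f3) would load the convexity budget).  (c) p2's TWO-TIER `j`-split is kept (`j ≤ 2` every admissible frame; `j ≤ 4` under
`FrameOK R U n μ K`, usable via `FrameOK.mono`): it cures the different, also-certain `∂_θʲ`, `j ≥ 3`, curve-wiggle defect (KT-S2 at the reading point).
(iii) WHAT THE CONSUMERS READ: the `twoLeg` slot is abstract in the glue (`inductionP2`/`k3_twoPointLimit_of_childrenP2`, `…SplitGenericV2`) and is
consumed only by child 2's inversion (self-map from (E3a-G) sizes via `frameOK_counterterm`-type lemmas, floor (E3b-G), contraction from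
(E3c-G), residual mass/slopes from `RenormalisedAtF`/`TwoLegSlopes`) and by child 4/5's assembly through `RenormalisedAtF` — all unchanged in
shape.

THE BUNDLE: `klPredsV6 := { frameOK := FrameOK, renorm := RenormalisedAtF, split := BetaSplitAtS, engine := EngineBoundsAtV4S, twoLeg :=
TwoLegStepV6 := TwoLegStepG (histV6) }` (all five fields explicit), `histV6 := BetaSplitAtS ∧ RenormalisedAtF ∧ EngineBoundsAtV4S` (so `HistP klPredsV6`
discharges (E3c-G)'s comparison-frame antecedent: `histV6_of_histP`); `split`/`engine` = the spin-(0,1) slots of record (`…SplitSpin01`; V4/V5 bound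
`BetaSplitAtV3`/`EngineBoundsAtV4`, superseded).  Children of record (restaged, `…SplitGenericV2`): `EngineP2 | BetaSplitP | CountertermP2 |
TwoPointAssemblyP klPredsV6 klWindowC` (5 children with `VolumeLimitP` once GenericV3 lands); glue `k3_twoPointLimit_of_childrenV6` here, the
K3-NAMED closer downstream of the route file.  Definitions + `rfl`/one-line lemmas only; nothing is asserted about the model.
-/

noncomputable section

namespace Summit.HubbardSuperconductivity.HubbardSuperconductivity.Theorems.KLRegimeSplit

set_option linter.dupNamespace false -- summit = problem name (single-conjunct summit), D-0017

open scoped InnerProductSpace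
open Real Finset Literature.MathematicalPhysics.QuantumLattice Literature.Probability.LatticeModels
open Literature.MathematicalPhysics.QuantumLattice.FermiRG
open Summit.HubbardSuperconductivity.HubbardSuperconductivity.Theorems.KLProgrammeLegKernels
open Summit.HubbardSuperconductivity.HubbardSuperconductivity.Theorems.DispersionFlow
open Summit.HubbardSuperconductivity.HubbardSuperconductivity.Theorems.PerturbedFermiCurve

/-! ## §1 The flat cutoff, the angular mean, the G-extension -/

/-- The inner radius of the FLAT cutoff, FIXED: `1/20` (`> 3/80 =` `FrameOK`'s tube radius, `> e₀ = 1/32`; transition on `(1/20, 1/10)`). -/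
def klFlatR : ℝ := 1 / 20

/-- **The FLAT tube cutoff of the free band** at a lattice momentum: `1 − χ₂((ε(k⃗) − μ)²/(4·klFlatR²))` — equal to `1` for `|ε − μ| ≤ 1/20`,
to `0` for `|ε − μ| ≥ 1/10`, smooth, frame-independent (Salmhofer's `χ₂`: `0` on `[0, ¼]`, `1` on `[1, ∞)`). -/
def klFlatCutoff (L : ℕ) [NeZero L] (μ : ℝ) (k : TorusSite 2 L) : ℝ :=
  1 - salmhoferCutoff ((nambuXi L μ k) ^ 2 / (4 * klFlatR ^ 2))

/-- **The angular mean** of a function on the circle of directions: `(2π)⁻¹ ∫₀^{2π} f(θ) dθ` — the momentum-independent part of an angular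
profile (for the local two-leg value: the tadpole / chemical-potential part), carried as a CONSTANT frame. -/
def klAngularMean (f : ℝ → ℝ) : ℝ := (2 * Real.pi)⁻¹ * ∫ θ in (0 : ℝ)..(2 * Real.pi), f θ

/-- **The G-extension of an angular function** (ONE interpolant): `k⃗ ↦ mean f + χ_flat(k⃗)·(f(θ(k⃗)) − mean f)` — constant part untouched by the
cutoff, mean-free part flat-extended along rays and cut off outside `|ε−μ| < 1/10`. -/
def klFrameExtG (L : ℕ) [NeZero L] (μ : ℝ) (f : ℝ → ℝ) : TrigPolyC4v :=
  symInterp L fun k => klAngularMean f + klFlatCutoff L μ k * (f (momentumAngle L k) - klAngularMean f)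

/-! ## §2 The G two-leg objects -/

section Model

variable (L M : ℕ) [NeZero L] [NeZero M]

/-- **`D_n(K)`, G-version** — the scale-`n` local part `ν_n(K)` (p2's `klLocalPart`, read on the frame's own Fermi curve) G-extended. -/
def klTwoLegPolyG (β U μ : ℝ) (K : TrigPolyC4v) (n : ℕ) : TrigPolyC4v :=
  klFrameExtG L μ (klLocalPart L M β U μ K n)

end Model

/-- **The normal form `P(K)`, G-version**: the G-extension of `K` read on its own curve, `θ ↦ K(klFermiPoint μ K θ)`. -/
def klFrameProjG (L : ℕ) [NeZero L] (μ : ℝ) (K : TrigPolyC4v) : TrigPolyC4v :=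
  klFrameExtG L μ fun θ => K.eval (klFermiPoint μ K θ)

section Model

variable (L M : ℕ) [NeZero L] [NeZero M]

/-- **The scale-`n` two-leg PIECE `ℓ_n(K)`, G-version**: `D_0(K) ⊖ P(K)` at `n = 0`, `D_n(K) ⊖ D_{n-1}(K)` for `n ≥ 1` (G-objects);
`Σ_{n ≤ N} ℓ_n = D_N ⊖ P(K)` pointwise (`sum_eval_klTwoLegPieceG`); child 2's map is `T(K) = P(K) ⊖ D_N(K) = −Σ_n ℓ_n(K)`. -/
def klTwoLegPieceG (β U μ : ℝ) (K : TrigPolyC4v) (n : ℕ) : TrigPolyC4v :=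
  if n = 0 then fsub (klTwoLegPolyG L M β U μ K 0) (klFrameProjG L μ K)
  else fsub (klTwoLegPolyG L M β U μ K n) (klTwoLegPolyG L M β U μ K (n - 1))

/-- The G-piece at scale `0`. -/
theorem klTwoLegPieceG_zero (β U μ : ℝ) (K : TrigPolyC4v) :
    klTwoLegPieceG L M β U μ K 0 = fsub (klTwoLegPolyG L M β U μ K 0) (klFrameProjG L μ K) := by
  simp [klTwoLegPieceG]

/-- The G-piece at scale `n + 1`. -/
theorem klTwoLegPieceG_succ (β U μ : ℝ) (K : TrigPolyC4v) (n : ℕ) :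
    klTwoLegPieceG L M β U μ K (n + 1) =
      fsub (klTwoLegPolyG L M β U μ K (n + 1)) (klTwoLegPolyG L M β U μ K n) := by
  simp [klTwoLegPieceG]

/-- **Telescoping of the G-pieces**: `Σ_{n ≤ N} ℓ_n(K)(p) = D_N(K)(p) − P(K)(p)`. -/
theorem sum_eval_klTwoLegPieceG (β U μ : ℝ) (K : TrigPolyC4v) (N : ℕ) (p : Fin 2 → ℝ) :
    ∑ n ∈ range (N + 1), (klTwoLegPieceG L M β U μ K n).eval p =
      (klTwoLegPolyG L M β U μ K N).eval p - (klFrameProjG L μ K).eval p := by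
  induction N with
  | zero => simp [klTwoLegPieceG_zero, eval_fsub]
  | succ N ih => rw [sum_range_succ, ih, klTwoLegPieceG_succ, eval_fsub]; ring

/-! ## §3 The v3 two-leg step clauses -/

/-- **(E3a-G) the sizes of the G-piece, TWO-TIER** (as p2's (E3a-F2)): orders `j ≤ 2` for EVERY admissible frame, orders `j ≤ 4` for frames
without structure finer than `n` (`FrameOK R U n μ K`).  With the G-extension the cutoff is flat wherever a shell or the `FrameOK` tube sits and bends only against the
SECOND-order mean-free increment, so the majorants `twoLegBar j n` (`uPow j U = U²` for `j ≥ 1`) are of the right order. -/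
def TwoLegSizesG (G : GeoConsts) (Q : EngConsts) (R : RenConsts) (β U μ : ℝ) (K : TrigPolyC4v) (n : ℕ) : Prop :=
  (∀ j ≤ 2, ∀ q : Momentum,
      ‖iteratedFDeriv ℝ j (evalM (klTwoLegPieceG L M β U μ K n)) q‖ ≤ twoLegBar G Q U j n) ∧
  (FrameOK R U n μ K → ∀ j ≤ 4, ∀ q : Momentum,
      ‖iteratedFDeriv ℝ j (evalM (klTwoLegPieceG L M β U μ K n)) q‖ ≤ twoLegBar G Q U j n)

/-- **(E3b-G)** the per-scale TANGENTIAL FLOOR of the G-piece along the level sets of the frame band inside the tube `{|e_K| < 3/80}`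
(DECOMP App. C: the umklapp-corner logarithm is convexity-ENHANCING; only summable / `O(|U|³)` junk is negative; the mean is a constant frame with
zero Hessian and `χ_flat ≡ 1` on the tube, so no cutoff slope enters). -/
def TwoLegFloorG (G : GeoConsts) (Q : EngConsts) (β U μ : ℝ) (K : TrigPolyC4v) (n : ℕ) : Prop :=
  ∀ p : Momentum, |frameLevel μ K p| < 3 / 80 → ∀ t : Momentum,
    inner ℝ (gradient (frameLevel μ K) p) t = 0 →
      -(bflBar G Q U n) * ‖t‖ ^ 2 ≤ hessQuad (evalM (klTwoLegPieceG L M β U μ K n)) p t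

/-- **(E3c-G)** the frame-LIPSCHITZ bound of the G-piece, with the comparison frame's history `hist` abstracted (the bundle supplies its own
split ∧ renorm ∧ engine): `sup_q |ℓ_n(K)(q) − ℓ_n(K′)(q)| ≤ lipBar n · frameDist K K′`. -/
def FrameLipschitzG (hist : TrigPolyC4v → ℕ → Prop) (G : GeoConsts) (Q : EngConsts) (R : RenConsts) (β U μ : ℝ)
    (K : TrigPolyC4v) (n : ℕ) : Prop :=
  ∀ K' : TrigPolyC4v, FrameOK R U (klTempScaleIdx β klE0) μ K' → (∀ j < n, hist K' j) →
    ∀ q : Fin 2 → ℝ,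
      |(klTwoLegPieceG L M β U μ K n).eval q - (klTwoLegPieceG L M β U μ K' n).eval q| ≤ lipBar G Q U n * frameDist K K'

/-- **`TwoLegStepG hist G P Q R … K n`** = (E3a-G) two-tier sizes ∧ (E3b-G) floor ∧ (E3c-G) frame-Lipschitz (history `hist`) ∧ (E3d/e)
`TwoLegSlopes` (p2's, unchanged — it reads the local part itself, not the pieces).  Same shape as p2's `TwoLegStepF2`; `P` is carried for
slot-shape uniformity. -/
def TwoLegStepG (hist : TrigPolyC4v → ℕ → Prop) (G : GeoConsts) (_P : SplitConsts) (Q : EngConsts) (R : RenConsts)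
    (β U μ : ℝ) (K : TrigPolyC4v) (n : ℕ) : Prop :=
  TwoLegSizesG L M G Q R β U μ K n ∧ TwoLegFloorG L M G Q β U μ K n ∧
    FrameLipschitzG L M hist G Q R β U μ K n ∧ TwoLegSlopes L M R β U μ K n

/-! ## §4 The V6 history, two-leg slot and bundle -/

/-- **The comparison-frame history of the V6 bundle** at scale `j`: `BetaSplitAtS ∧ RenormalisedAtF ∧ EngineBoundsAtV4S` at `j`. -/
def histV6 (G : GeoConsts) (P : SplitConsts) (Q : EngConsts) (R : RenConsts) (β U μ : ℝ) : TrigPolyC4v → ℕ → Prop :=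
  fun K' j => BetaSplitAtS L M G P Q β U μ K' j ∧ RenormalisedAtF L M β U μ K' R j ∧ EngineBoundsAtV4S L M G P Q β U μ K' j

/-- **`TwoLegStepV6 … G P Q R K n`** := `TwoLegStepG` read at the V6 history `histV6`.  Same slot type as `Preds.twoLeg`. -/
def TwoLegStepV6 (G : GeoConsts) (P : SplitConsts) (Q : EngConsts) (R : RenConsts) (β U μ : ℝ) (K : TrigPolyC4v) (n : ℕ) :
    Prop :=
  TwoLegStepG L M (histV6 L M G P Q R β U μ) G P Q R β U μ K n

end Model

/-- **`klPredsV6 : Preds`** := `{ frameOK := FrameOK, renorm := RenormalisedAtF, split := BetaSplitAtS, engine := EngineBoundsAtV4S,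
twoLeg := TwoLegStepV6 }`.  Children of record: `EngineP2 klPredsV6 klWindowC`, `BetaSplitP klPredsV6 klWindowC`,
`CountertermP2 klPredsV6 klWindowC`, `TwoPointAssemblyP klPredsV6 klWindowC` (`…SplitGenericV2`). -/
def klPredsV6 : Preds where
  frameOK := FrameOK
  renorm := fun L M _ _ β U μ K R n => RenormalisedAtF L M β U μ K R n
  split := fun L M _ _ G P Q β U μ K n => BetaSplitAtS L M G P Q β U μ K n
  engine := fun L M _ _ G P Q β U μ K n => EngineBoundsAtV4S L M G P Q β U μ K n
  twoLeg := fun L M _ _ G P Q R β U μ K n => TwoLegStepV6 L M G P Q R β U μ K n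

/-- V6's frame class IS `FrameOK` (= V5's = V3's). -/
theorem klPredsV6_frameOK : klPredsV6.frameOK = klPredsV5.frameOK := rfl

/-- V6's renormalisation slot IS V5's (`RenormalisedAtF`). -/
theorem klPredsV6_renorm : klPredsV6.renorm = klPredsV5.renorm := rfl

/-- V6's split slot is `BetaSplitAtS`. -/
theorem klPredsV6_split (L M : ℕ) [NeZero L] [NeZero M] (G : GeoConsts) (P : SplitConsts) (Q : EngConsts) (β U μ : ℝ)
    (K : TrigPolyC4v) (n : ℕ) : klPredsV6.split L M G P Q β U μ K n = BetaSplitAtS L M G P Q β U μ K n := rfl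

/-- V6's engine slot is `EngineBoundsAtV4S`. -/
theorem klPredsV6_engine (L M : ℕ) [NeZero L] [NeZero M] (G : GeoConsts) (P : SplitConsts) (Q : EngConsts) (β U μ : ℝ)
    (K : TrigPolyC4v) (n : ℕ) : klPredsV6.engine L M G P Q β U μ K n = EngineBoundsAtV4S L M G P Q β U μ K n := rfl

/-- V6's two-leg slot is `TwoLegStepV6`. -/
theorem klPredsV6_twoLeg (L M : ℕ) [NeZero L] [NeZero M] (G : GeoConsts) (P : SplitConsts) (Q : EngConsts) (R : RenConsts)
    (β U μ : ℝ) (K : TrigPolyC4v) (n : ℕ) :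
    klPredsV6.twoLeg L M G P Q R β U μ K n = TwoLegStepV6 L M G P Q R β U μ K n := rfl

/-- The V6 history at `j` unfolds to the three V6 slots at `j`: `HistP klPredsV6 … n` gives `histV6 … K j` for every `j < n` (child 2 can
discharge (E3c-G)'s comparison-frame antecedent for the frames it compares). -/
theorem histV6_of_histP {L M : ℕ} [NeZero L] [NeZero M] {G : GeoConsts} {P : SplitConsts} {Q : EngConsts} {R : RenConsts}
    {β U μ : ℝ} {K : TrigPolyC4v} {n : ℕ} (h : HistP klPredsV6 L M G P Q R β U μ K n) :
    ∀ j < n, histV6 L M G P Q R β U μ K j := fun j hj =>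
  ⟨(h j hj).1, (h j hj).2.1, (h j hj).2.2.1⟩

/-! ## §5 Glue at V6 (K3's body from the restaged children; the K3-NAMED closer lives downstream of the route file) -/

/-- **The crux modulo S0, from the restaged children at `klPredsV6`** (`k3_twoPointLimit_of_childrenP2` at this bundle). -/
theorem k3_twoPointLimit_of_childrenV6 (h₃ : EngineP2 klPredsV6 klWindowC) (h₁ : BetaSplitP klPredsV6 klWindowC)
    (h₂ : CountertermP2 klPredsV6 klWindowC) (h₄ : TwoPointAssemblyP klPredsV6 klWindowC)
    (hS0 : ∀ δ ∈ Set.Icc (0.10 : ℝ) 0.35,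
      chemicalPotentialOfDensity (squareDispersion 1 0) (1 - δ) ∈ Set.Icc (-1 : ℝ) (-0.15)) :
    ∀ a : ℝ, 0 < a → ∃ U₀ c : ℝ, 0 < U₀ ∧ 0 < c ∧ ∀ δ ∈ Set.Icc (0.10 : ℝ) 0.35, ∀ U β : ℝ, 0 < U → U ≤ U₀ →
      Real.exp (a / U) ≤ β → β ≤ Real.exp (c / U ^ 2) → ∀ (x y : Site 2) (σ σ' : Fin 2), ∃ S : ℂ,
        Filter.Tendsto (fun L : ℕ => hubbardThermalTwoPoint β U
          (chemicalPotentialOfDensity (squareDispersion 1 0) (1 - δ)) L x y σ σ') Filter.atTop (nhds S) :=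
  k3_twoPointLimit_of_childrenP2 h₃ h₁ h₂ h₄ hS0

end Summit.HubbardSuperconductivity.HubbardSuperconductivity.Theorems.KLRegimeSplit

end
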